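import Mathlib
import HarnessLib
import Literature.Analysis.Convex.LinearProgrammingDuality

/-!
# Reduction of linear inequalities: redundant equations, null variables, nonextremal variables
# (Luenberger–Ye, §4.7)

[LY08] = D. G. Luenberger, Y. Ye, *Linear and Nonlinear Programming* [LuenbergerYe2008], chapter
"Duality" (Ch. 4 in the held copy `book:luenberger2008-linear-nonlinear-programming` and in the
Springer 2008 printing), §4.7 "Reduction of linear inequalities": the system (19)/(21)/(26)
`Ax = b, x ≥ 0` with solution set `S`; redundant equations (20); **null variables** (a variable
with `x_i = 0` in every solution) and the **Null Variable Theorem** with its certificate (22)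
`λᵀA ≥ 0, λᵀb = 0, (λᵀA)_i > 0`; **nonextremal variables** (the inequality `x_j ≥ 0` is redundant)
and the **Nonextremal Variable Theorem** with its certificate (27)/(28) `λᵀA = dᵀ`, `d_j = −1`,
`d_i ≥ 0 (i ≠ j)`, `λᵀb = −β`, `β ≥ 0`.

The book proves the "only if" halves from the Duality Theorem of §4.2; we obtain them from the
equivalent Farkas lemma already in the tree
(`Literature.Analysis.Convex.LPDuality.farkas_nonneg_eq`, Schrijver Cor. 7.1d), applied to the
matrix `[A, −b]` and the right-hand side `−a_i`: either the certificate exists, or there is a ray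
`x ≥ 0`, `t ≥ 0` with `Ax = tb`, `x_i ≥ 1`, which produces a solution with `x_i > 0`
(`t > 0`: `x/t`; `t = 0`: `x₀ + x` for any `x₀ ∈ S`).

Results recorded:
* `IsNullVariable`, `IsNonextremal` — the two definitions; `redundant_of_certificate` — (20) read
  as "one equation is a combination of the others" in the form `λᵀ(Ax − b) = 0` for every `x`;
* `certificate_or_ray` — the Farkas alternative used for both "only if" halves;
* `nullVariable_of_certificate` — the "if" half of the Null Variable Theorem ((22) ⇒ null), and
  `nullVariable_iff` — the **Null Variable Theorem** (for `S ≠ ∅`);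
* `nonextremal_of_certificate` — the "if" half of the Nonextremal Variable Theorem
  (`x_j = β + Σ_{i ≠ j} d_i x_i ≥ 0`), and `nonextremal_iff` — the **Nonextremal Variable Theorem**
  (for `S ≠ ∅`), obtained from the null-variable certificate of the system with column `j` negated.

Published results only (Lean placement rule): every public declaration carries its
`[cite: LuenbergerYe2008, §4.7 …]` locator.
-/

namespace Literature.Analysis.Convex.NullVariableTheorem

open Matrix Finset

variable {m n : Type*} [Fintype m] [Fintype n]

/-- A variable `x_i` of the system (21) `Ax = b, x ≥ 0` is a **null variable** if `x_i = 0` in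
every solution. [cite: LuenbergerYe2008, §4.7 Definition (null variable)] -/
def IsNullVariable (A : Matrix m n ℝ) (b : m → ℝ) (i : n) : Prop :=
  ∀ x : n → ℝ, 0 ≤ x → A *ᵥ x = b → x i = 0

/-- A variable `x_j` of the system (26) `Ax = b, x ≥ 0` is **nonextremal** if the inequality
`x_j ≥ 0` is redundant: every `x` with `Ax = b` and `x_i ≥ 0` for `i ≠ j` has `x_j ≥ 0`.
[cite: LuenbergerYe2008, §4.7 Definition (nonextremal variable)] -/
def IsNonextremal (A : Matrix m n ℝ) (b : m → ℝ) (j : n) : Prop :=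
  ∀ x : n → ℝ, (∀ i, i ≠ j → 0 ≤ x i) → A *ᵥ x = b → 0 ≤ x j

/-- (20): a nonzero `λ` with `λᵀA = 0`, `λᵀb = 0` is a linear dependence among the equations —
`λᵀ(Ax − b) = 0` identically, so any equation with `λ_k ≠ 0` is a combination of the others.
[cite: LuenbergerYe2008, §4.7 Definition (redundant equations) (20)] -/
theorem redundant_of_certificate (A : Matrix m n ℝ) (b lam : m → ℝ) (hA : lam ᵥ* A = 0)
    (hb : lam ⬝ᵥ b = 0) (x : n → ℝ) : lam ⬝ᵥ (A *ᵥ x - b) = 0 := by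
  rw [dotProduct_sub, dotProduct_mulVec, hA, zero_dotProduct, hb, sub_zero]

/-- The "if" half of the Null Variable Theorem: a combination of the equations
`ξ₁x₁ + ⋯ + ξ_nx_n = 0` (`ξ = λᵀA ≥ 0`, `λᵀb = 0`) forces `x_i = 0` wherever `ξ_i > 0`.
[cite: LuenbergerYe2008, §4.7 Null Variable Theorem ("if" part) and the display before it] -/
theorem nullVariable_of_certificate (A : Matrix m n ℝ) (b : m → ℝ) {lam : m → ℝ}
    (hA : 0 ≤ lam ᵥ* A) (hb : lam ⬝ᵥ b = 0) {i : n} (hi : 0 < (lam ᵥ* A) i) :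
    IsNullVariable A b i := by
  intro x hx hAx
  have hsum : (lam ᵥ* A) ⬝ᵥ x = 0 := by rw [← dotProduct_mulVec, hAx, hb]
  have hterm : ∀ k ∈ (univ : Finset n), 0 ≤ (lam ᵥ* A) k * x k :=
    fun k _ => mul_nonneg (hA k) (hx k)
  have hk := (sum_eq_zero_iff_of_nonneg hterm).1 hsum i (mem_univ i)
  rcases mul_eq_zero.1 hk with h | h
  · exact absurd h hi.ne'
  · exact h

/-- [folklore] The matrix `[A, −b]` (columns indexed by `n ⊕ Unit`) used to read the certificates
off Farkas' lemma (proof device only). -/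
private def augMatrix (A : Matrix m n ℝ) (b : m → ℝ) : Matrix m (n ⊕ Unit) ℝ :=
  Matrix.of fun r s => Sum.elim (fun k => A r k) (fun _ => -b r) s

omit [Fintype m] in
/-- [folklore] `[A, −b](z; t) = Az − tb`. -/
private theorem augMatrix_mulVec (A : Matrix m n ℝ) (b : m → ℝ) (z : n ⊕ Unit → ℝ) :
    augMatrix A b *ᵥ z = A *ᵥ (fun k => z (Sum.inl k)) - z (Sum.inr ()) • b := by
  ext r
  simp only [augMatrix, mulVec, dotProduct, Matrix.of_apply, Fintype.sum_sum_type, Sum.elim_inl,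
    Sum.elim_inr, Finset.univ_unique, Finset.sum_singleton, Pi.sub_apply, Pi.smul_apply,
    smul_eq_mul]
  simp only [PUnit.default_eq_unit]
  ring

omit [Fintype n] in
/-- [folklore] `(λᵀ[A, −b])_k = (λᵀA)_k` on the `A`-columns. -/
private theorem vecMul_augMatrix_inl (A : Matrix m n ℝ) (b lam : m → ℝ) (k : n) :
    (lam ᵥ* augMatrix A b) (Sum.inl k) = (lam ᵥ* A) k := by
  simp [augMatrix, vecMul, dotProduct, Matrix.of_apply]

omit [Fintype n] in
/-- [folklore] `(λᵀ[A, −b])` on the last column is `−λᵀb`. -/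
private theorem vecMul_augMatrix_inr (A : Matrix m n ℝ) (b lam : m → ℝ) :
    (lam ᵥ* augMatrix A b) (Sum.inr ()) = -(lam ⬝ᵥ b) := by
  simp [augMatrix, vecMul, dotProduct, Matrix.of_apply, Finset.sum_neg_distrib]

/-- The alternative behind both theorems: for a column index `i`, either there is a certificate
`λ` with `λᵀA ≥ 0`, `λᵀb ≤ 0`, `(λᵀA)_i > 0`, or there are `x ≥ 0`, `t ≥ 0` with `Ax = tb` and
`x_i ≥ 1`. [cite: LuenbergerYe2008, §4.7 proof of the Null Variable Theorem (duality step)] -/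
theorem certificate_or_ray (A : Matrix m n ℝ) (b : m → ℝ) (i : n) :
    (∃ lam : m → ℝ, 0 ≤ lam ᵥ* A ∧ lam ⬝ᵥ b ≤ 0 ∧ 0 < (lam ᵥ* A) i) ∨
      ∃ (x : n → ℝ) (t : ℝ), 0 ≤ x ∧ 0 ≤ t ∧ A *ᵥ x = t • b ∧ 1 ≤ x i := by
  classical
  by_cases h : ∃ z : n ⊕ Unit → ℝ, 0 ≤ z ∧ augMatrix A b *ᵥ z = -(fun r => A r i)
  · right
    obtain ⟨z, hz, hAz⟩ := h
    refine ⟨(fun k => z (Sum.inl k)) + Pi.single i 1, z (Sum.inr ()), ?_, hz _, ?_, ?_⟩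
    · intro k
      have h0 : 0 ≤ z (Sum.inl k) := hz _
      simp only [Pi.add_apply, Pi.zero_apply]
      by_cases hk : k = i
      · subst hk; rw [Pi.single_eq_same]; linarith
      · rw [Pi.single_eq_of_ne hk, add_zero]; exact h0
    · rw [augMatrix_mulVec, sub_eq_iff_eq_add] at hAz
      rw [mulVec_add, hAz]
      have : A *ᵥ Pi.single i (1 : ℝ) = fun r => A r i := by
        ext r; rw [mulVec_single, MulOpposite.op_one, one_smul]; rfl
      rw [this]; abel
    · have h0 : 0 ≤ z (Sum.inl i) := hz _
      simp only [Pi.add_apply, Pi.single_eq_same]; linarith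
  · left
    have hf := (LPDuality.farkas_nonneg_eq (augMatrix A b) (-(fun r => A r i))).not.1 h
    obtain ⟨lam, hlam'⟩ := not_forall.1 hf
    obtain ⟨hlam, hneg'⟩ := Classical.not_imp.1 hlam'
    have hneg := not_le.1 hneg'
    refine ⟨lam, fun k => ?_, ?_, ?_⟩
    · have := hlam (Sum.inl k); rwa [Pi.zero_apply, vecMul_augMatrix_inl] at this
    · have := hlam (Sum.inr ()); rw [Pi.zero_apply, vecMul_augMatrix_inr] at this; linarith
    · have h1 : lam ⬝ᵥ (-(fun r => A r i)) = -((lam ᵥ* A) i) := by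
        rw [dotProduct_neg]; rfl
      rw [h1] at hneg; linarith

/-- **Null Variable Theorem.** If `S ≠ ∅`, the variable `x_i` is a null variable of
`Ax = b, x ≥ 0` iff there is a nonzero `λ` with `λᵀA ≥ 0`, `λᵀb = 0` and `(λᵀA)_i > 0` (22).
[cite: LuenbergerYe2008, §4.7 Null Variable Theorem] -/
theorem nullVariable_iff (A : Matrix m n ℝ) (b : m → ℝ) {i : n}
    (hS : ∃ x : n → ℝ, 0 ≤ x ∧ A *ᵥ x = b) :
    IsNullVariable A b i ↔
      ∃ lam : m → ℝ, lam ≠ 0 ∧ 0 ≤ lam ᵥ* A ∧ lam ⬝ᵥ b = 0 ∧ 0 < (lam ᵥ* A) i := by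
  constructor
  · intro hnull
    obtain ⟨x₀, hx₀, hAx₀⟩ := hS
    rcases certificate_or_ray A b i with ⟨lam, hA, hb, hi⟩ | ⟨x, t, hx, ht, hAx, hxi⟩
    · have hb0 : 0 ≤ lam ⬝ᵥ b := by
        rw [← hAx₀, dotProduct_mulVec]
        exact dotProduct_nonneg_of_nonneg hA hx₀
      refine ⟨lam, ?_, hA, le_antisymm hb hb0, hi⟩
      rintro rfl
      rw [zero_vecMul, Pi.zero_apply] at hi
      exact lt_irrefl _ hi
    · exfalso
      rcases ht.eq_or_lt with ht0 | htpos
      · -- `t = 0`: `x₀ + x` is a solution with `i`th component ≥ 1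
        have h1 := hnull (x₀ + x) (add_nonneg hx₀ hx) (by rw [mulVec_add, hAx₀, hAx, ← ht0, zero_smul, add_zero])
        have h2 : 0 ≤ x₀ i := hx₀ i
        rw [Pi.add_apply] at h1
        linarith
      · -- `t > 0`: `x / t` is a solution with `i`th component ≥ 1/t
        have h1 := hnull (t⁻¹ • x) (smul_nonneg (inv_nonneg.2 ht) hx)
          (by rw [mulVec_smul, hAx, smul_smul, inv_mul_cancel₀ htpos.ne', one_smul])
        rw [Pi.smul_apply, smul_eq_mul] at h1
        have h3 : 0 < t⁻¹ * x i := mul_pos (inv_pos.2 htpos) (by linarith)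
        linarith
  · rintro ⟨lam, -, hA, hb, hi⟩
    exact nullVariable_of_certificate A b hA hb hi

/-- The "if" half of the Nonextremal Variable Theorem: the combination (27)/(28) of the equations
reads `x_j = β + Σ_{i ≠ j} d_ix_i`, so `x_j ≥ 0` whenever the other variables are nonnegative.
[cite: LuenbergerYe2008, §4.7 Nonextremal Variable Theorem ("if" part)] -/
theorem nonextremal_of_certificate (A : Matrix m n ℝ) (b : m → ℝ) {j : n}
    {lam : m → ℝ} {β : ℝ} (hj : (lam ᵥ* A) j = -1) (hd : ∀ i, i ≠ j → 0 ≤ (lam ᵥ* A) i)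
    (hb : lam ⬝ᵥ b = -β) (hβ : 0 ≤ β) : IsNonextremal A b j := by
  classical
  intro x hx hAx
  have hsum : (lam ᵥ* A) ⬝ᵥ x = -β := by rw [← dotProduct_mulVec, hAx, hb]
  unfold dotProduct at hsum
  rw [← Finset.add_sum_erase _ _ (mem_univ j), hj] at hsum
  have hP : 0 ≤ ∑ i ∈ univ.erase j, (lam ᵥ* A) i * x i :=
    sum_nonneg fun i hi => mul_nonneg (hd i (ne_of_mem_erase hi)) (hx i (ne_of_mem_erase hi))
  linarith

/-- [folklore] The system with column `j` negated (proof device only): its null-variable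
certificate is the nonextremal certificate of the original system. -/
private def negCol [DecidableEq n] (A : Matrix m n ℝ) (j : n) : Matrix m n ℝ :=
  Matrix.of fun r k => if k = j then -A r k else A r k

omit [Fintype m] in
/-- [folklore] `(A with column j negated)x = A(x with x_j negated)`. -/
private theorem negCol_mulVec [DecidableEq n] (A : Matrix m n ℝ) (j : n) (x : n → ℝ) :
    negCol A j *ᵥ x = A *ᵥ fun k => if k = j then -x k else x k := by
  ext r
  simp only [negCol, mulVec, dotProduct, Matrix.of_apply]
  refine sum_congr rfl fun k _ => ?_
  split_ifs <;> ring

omit [Fintype n] in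
/-- [folklore] `λᵀ(A with column j negated)` negates the `j`th component of `λᵀA`. -/
private theorem vecMul_negCol [DecidableEq n] (A : Matrix m n ℝ) (j : n) (lam : m → ℝ) (k : n) :
    (lam ᵥ* negCol A j) k = if k = j then -(lam ᵥ* A) k else (lam ᵥ* A) k := by
  simp only [negCol, vecMul, dotProduct, Matrix.of_apply]
  split_ifs
  · rw [← sum_neg_distrib]; exact sum_congr rfl fun r _ => by ring
  · rfl

/-- **Nonextremal Variable Theorem.** If `S ≠ ∅`, the variable `x_j` is nonextremal for
`Ax = b, x ≥ 0` iff there are `λ` and `β ≥ 0` with `d = λᵀA`, `d_j = −1`, `d_i ≥ 0 (i ≠ j)` (27)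
and `λᵀb = −β` (28). [cite: LuenbergerYe2008, §4.7 Nonextremal Variable Theorem] -/
theorem nonextremal_iff (A : Matrix m n ℝ) (b : m → ℝ) {j : n}
    (hS : ∃ x : n → ℝ, 0 ≤ x ∧ A *ᵥ x = b) :
    IsNonextremal A b j ↔ ∃ (lam : m → ℝ) (β : ℝ), (lam ᵥ* A) j = -1 ∧
      (∀ i, i ≠ j → 0 ≤ (lam ᵥ* A) i) ∧ lam ⬝ᵥ b = -β ∧ 0 ≤ β := by
  classical
  constructor
  · intro hne
    obtain ⟨x₀, hx₀, hAx₀⟩ := hS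
    rcases certificate_or_ray (negCol A j) b j with ⟨lam, hA, hb, hjj⟩ | ⟨x, t, hx, ht, hAx, hxj⟩
    · rw [vecMul_negCol, if_pos rfl] at hjj
      have hs : 0 < -(lam ᵥ* A) j := hjj
      set s := -(lam ᵥ* A) j with hs_def
      refine ⟨s⁻¹ • lam, -((s⁻¹ • lam) ⬝ᵥ b), ?_, ?_, ?_, ?_⟩
      · rw [smul_vecMul, Pi.smul_apply, smul_eq_mul]
        have : (lam ᵥ* A) j = -s := by rw [hs_def, neg_neg]
        rw [this, mul_neg, inv_mul_cancel₀ hs.ne']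
      · intro i hij
        have h := hA i
        rw [Pi.zero_apply, vecMul_negCol, if_neg hij] at h
        rw [smul_vecMul, Pi.smul_apply, smul_eq_mul]
        exact mul_nonneg (inv_nonneg.2 hs.le) h
      · rw [neg_neg]
      · rw [smul_dotProduct, smul_eq_mul, neg_nonneg]
        exact mul_nonpos_of_nonneg_of_nonpos (inv_nonneg.2 hs.le) hb
    · exfalso
      rw [negCol_mulVec] at hAx
      set x' : n → ℝ := fun k => if k = j then -x k else x k with hx'_def
      have hx'i : ∀ i, i ≠ j → 0 ≤ x' i := fun i hij => by
        simp only [hx'_def, if_neg hij]; exact hx i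
      have hx'j : x' j = -x j := by simp only [hx'_def, if_pos rfl]
      rcases ht.eq_or_lt with ht0 | htpos
      · -- `t = 0`: move from `x₀` along the direction `x'`
        set c := x₀ j + 1 with hc_def
        have hc : 0 < c := by have h0 : 0 ≤ x₀ j := hx₀ j; linarith
        have h1 := hne (x₀ + c • x') (fun i hij => by
            rw [Pi.add_apply, Pi.smul_apply, smul_eq_mul]
            exact add_nonneg (hx₀ i) (mul_nonneg hc.le (hx'i i hij)))
          (by rw [mulVec_add, mulVec_smul, hAx₀, hAx, ← ht0, zero_smul, smul_zero, add_zero])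
        rw [Pi.add_apply, Pi.smul_apply, smul_eq_mul, hx'j] at h1
        have h2 : c ≤ c * x j := by nlinarith
        linarith
      · -- `t > 0`: `x' / t` violates `x_j ≥ 0`
        have h1 := hne (t⁻¹ • x') (fun i hij => by
            rw [Pi.smul_apply, smul_eq_mul]
            exact mul_nonneg (inv_nonneg.2 ht) (hx'i i hij))
          (by rw [mulVec_smul, hAx, smul_smul, inv_mul_cancel₀ htpos.ne', one_smul])
        rw [Pi.smul_apply, smul_eq_mul, hx'j] at h1
        have h3 : 0 < t⁻¹ * x j := mul_pos (inv_pos.2 htpos) (by linarith)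
        linarith
  · rintro ⟨lam, β, hj, hd, hb, hβ⟩
    exact nonextremal_of_certificate A b hj hd hb hβ

end Literature.Analysis.Convex.NullVariableTheorem
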